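import Mathlib
import Summits.ABC.ABC.Theses.FeketeScales

/-!
# Sketch — crux-ideate stmt-ABC-2160 (ScaleSubmultiplicativity), ideator 3, round 1

First lemmas (signatures only; `sorry`-free DEFINITIONS of the Props, no proofs claimed) for the
idea card `core-dichotomy-primitive-envelope` and the barrier notes `BarrierNotesIdeator3.md`.
-/

namespace Summit.ABC.ABC.Cruxes.ScaleSubmultiplicativity.Sketch

open Literature.NumberTheory.DiophantineGeometry

/-- The crux inequality AT one triple `(a,b,c)` and one split `(R₁,R₂)` with parameters `(θ,K)`:
the G-free conclusion of `ScaleSubmultiplicativity` with the outer quantifiers stripped. -/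
def SubmultAt (θ K : ℝ) (R₁ R₂ a b c : ℕ) : Prop :=
  ∃ a₁ b₁ c₁ a₂ b₂ c₂ : ℕ, IsABCTriple a₁ b₁ c₁ ∧ rad a₁ b₁ c₁ ≤ R₁ ∧ IsABCTriple a₂ b₂ c₂ ∧
    rad a₂ b₂ c₂ ≤ R₂ ∧ (c : ℝ) ≤ K * Real.exp (Real.log ((R₁ : ℝ) * R₂) ^ θ) * c₁ * c₂

/-- Regression: the crux is `∃ θ<1, K>0, R₀, ∀ R₁ R₂ ≥ R₀, ∀ triples with rad ≤ R₁R₂, SubmultAt`. -/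
theorem scaleSubmultiplicativity_iff :
    Summit.ABC.ABC.Theses.FeketeScales.ScaleSubmultiplicativity ↔
      ∃ θ : ℝ, θ < 1 ∧ ∃ K : ℝ, 0 < K ∧ ∃ R₀ : ℕ, ∀ R₁ R₂ : ℕ, R₀ ≤ R₁ → R₀ ≤ R₂ →
        ∀ a b c : ℕ, IsABCTriple a b c → rad a b c ≤ R₁ * R₂ → SubmultAt θ K R₁ R₂ a b c :=
  Iff.rfl

/-- RUNG 1 (provable now, ≈ 80 lines): NON-BURSTS ARE FREE. If the excess of `(a,b,c)` is at most
`(log rad)^θ + B`, i.e. `c ≤ e^B · rad · exp((log rad)^θ)`, then the crux inequality holds at that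
triple for EVERY split `R₁, R₂ ≥ 4` with `K = 16 e^B`, the shadows being `(1, 2^k − 1, 2^k)` with
`2^{k+1} ≤ R_i < 2^{k+2}` (so `c_i = 2^k > R_i/4`, `rad ≤ 2(2^k−1) < R_i`). Needs `0 ≤ θ` for the
monotonicity `(log rad)^θ ≤ (log R₁R₂)^θ`. Hence the crux is equivalent to its restriction to
θ-BURSTS `{c > e^B rad exp((log rad)^θ)}`. -/
def NonBurstSubmult : Prop :=
  ∀ θ B : ℝ, 0 ≤ θ → ∀ R₁ R₂ : ℕ, 4 ≤ R₁ → 4 ≤ R₂ → ∀ a b c : ℕ, IsABCTriple a b c →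
    rad a b c ≤ R₁ * R₂ →
    (c : ℝ) ≤ Real.exp B * (rad a b c : ℝ) * Real.exp (Real.log (rad a b c : ℝ) ^ θ) →
    SubmultAt θ (16 * Real.exp B) R₁ R₂ a b c

/-- RUNG 2 (provable now, elementary): THE DYADIC HEREDITARY FACTORISATION. For coprime `y < x` and
`d ≥ 1` the "difference triple" `D_{2d} = (y^{2d}, x^{2d} − y^{2d}, x^{2d})` FACTORS into the two
abc triples `D_d = (y^d, x^d − y^d, x^d)` and `S_d = (y^d, x^d, x^d + y^d)`: their `c`-product
dominates `c(D_{2d}) = x^{2d}` and their radical product divides `2·rad(xy)·rad(D_{2d})`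
(because `x^{2d} − y^{2d} = (x^d − y^d)(x^d + y^d)` with `gcd ∣ 2`). This is the ONLY exact
sub-multiplicativity identity for triples found in this session (the in-core shadow mechanism of
the card); it serves the one split `(rad S_d, rad D_d)` of `D_{2d}` with `K = 2 rad(xy)`, `θ`-free. -/
def DyadicHereditaryFactorisation : Prop :=
  ∀ x y d : ℕ, 0 < y → y < x → Nat.Coprime x y → 0 < d →
    IsABCTriple (y ^ (2 * d)) (x ^ (2 * d) - y ^ (2 * d)) (x ^ (2 * d)) ∧
    IsABCTriple (y ^ d) (x ^ d - y ^ d) (x ^ d) ∧ IsABCTriple (y ^ d) (x ^ d) (x ^ d + y ^ d) ∧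
    x ^ (2 * d) ≤ x ^ d * (x ^ d + y ^ d) ∧
    rad (y ^ d) (x ^ d - y ^ d) (x ^ d) * rad (y ^ d) (x ^ d) (x ^ d + y ^ d) ∣
      2 * UniqueFactorizationMonoid.radical (x * y) *
        rad (y ^ (2 * d)) (x ^ (2 * d) - y ^ (2 * d)) (x ^ (2 * d))

/-- A triple has POWER SHAPE (is imprimitive in one of its three core lattices) iff two of its
members are perfect `j`-th powers for one `j ≥ 2` (Fermat–Catalan shapes `x^j + y^j = c`,
`x^j + b = z^j`, `a + y^j = z^j`). -/
def IsPowerShape (a b c : ℕ) : Prop :=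
  ∃ j : ℕ, 2 ≤ j ∧ ((∃ x y : ℕ, a = x ^ j ∧ b = y ^ j) ∨ (∃ x z : ℕ, a = x ^ j ∧ c = z ^ j) ∨
    (∃ y z : ℕ, b = y ^ j ∧ c = z ^ j))

/-- STUB (P) of the line — PRIMITIVE SUB-POWER ENVELOPE (open; RST-lite on the complement of the
power shapes): some `θ < 1` and `B` with `c ≤ e^B rad exp((log rad)^θ)` for every abc triple that
is NOT of power shape. Strictly weaker than the hypothesis of `SubmultOfRST` (which asks it for all
triples); by `NonBurstSubmult` it settles the crux at every primitive triple. No mechanism is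
claimed for (P): see the card's Barriers and BarrierNotesIdeator3.md §B1 (primitive bursts have
provable in-core DESERTS, so every proof of the crux must bound them pointwise). -/
def PrimitiveSubpowerEnvelope : Prop :=
  ∃ θ : ℝ, 0 ≤ θ ∧ θ < 1 ∧ ∃ B : ℝ, ∀ a b c : ℕ, IsABCTriple a b c → ¬ IsPowerShape a b c →
    (c : ℝ) ≤ Real.exp B * (rad a b c : ℝ) * Real.exp (Real.log (rad a b c : ℝ) ^ θ)

/-- STUB (W) of the line — the crux restricted to POWER SHAPES (open; by the hereditary shadows it
reduces, orbit by orbit, to sub-power control of the Wieferich excess of complementary cyclotomic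
factors `Φ_e(x,y)`; state of the art `log rad(u_n) ≫ (log n)²/log log n`, Shorey 1983 Thm 1 /
Stewart 2008). -/
def PowerShapeSubmult : Prop :=
  ∃ θ : ℝ, 0 ≤ θ ∧ θ < 1 ∧ ∃ K : ℝ, 0 < K ∧ ∃ R₀ : ℕ, ∀ R₁ R₂ : ℕ, R₀ ≤ R₁ → R₀ ≤ R₂ →
    ∀ a b c : ℕ, IsABCTriple a b c → IsPowerShape a b c → rad a b c ≤ R₁ * R₂ →
    SubmultAt θ K R₁ R₂ a b c

/-- COMPOSITION of the line (provable now from `NonBurstSubmult`, taking `θ := max θ_P θ_W`,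
`K := max (16 e^B) K_W`, `R₀ := max 4 R₀_W`): the two stubs conclude the crux BY NAME. -/
def LineComposition : Prop :=
  NonBurstSubmult → PrimitiveSubpowerEnvelope → PowerShapeSubmult →
    Summit.ABC.ABC.Theses.FeketeScales.ScaleSubmultiplicativity

/-- CALIBRATION (provable now from the named fact `stewart_yu`, abc.S06): the crux's inequality
with the Stewart–Yu slack `exp(κ (R₁R₂)^{1/3} (log R₁R₂)^3)` in place of `exp((log R₁R₂)^θ)` holds
unconditionally with `K = 16` — the trivial "pointwise ÷ (R_i/4)" bound; every slack between the
two is equivalent, given `G(R) ≥ R/4` and the Fekete iteration, to a pointwise abc bound of the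
same strength (BarrierNotesIdeator3.md §A9), so there is no intermediate rung of sub-multiplicative
type that is not an improvement of Stewart–Yu. -/
def StewartYuSlackSubmult : Prop :=
  Literature.NumberTheory.DiophantineGeometry.stewart_yu →
    ∃ κ : ℝ, 0 < κ ∧ ∀ R₁ R₂ : ℕ, 4 ≤ R₁ → 4 ≤ R₂ → ∀ a b c : ℕ, IsABCTriple a b c →
      rad a b c ≤ R₁ * R₂ →
      ∃ a₁ b₁ c₁ a₂ b₂ c₂ : ℕ, IsABCTriple a₁ b₁ c₁ ∧ rad a₁ b₁ c₁ ≤ R₁ ∧ IsABCTriple a₂ b₂ c₂ ∧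
        rad a₂ b₂ c₂ ≤ R₂ ∧
        (c : ℝ) ≤ 16 * Real.exp (κ * ((R₁ : ℝ) * R₂) ^ ((1 : ℝ) / 3) *
          Real.log ((R₁ : ℝ) * R₂) ^ (3 : ℕ)) * c₁ * c₂

end Summit.ABC.ABC.Cruxes.ScaleSubmultiplicativity.Sketch
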